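import Literature.Analysis.FunctionSpaces.ItoFormulaProofs
import Literature.Analysis.FunctionSpaces.ItoIntegralLocalization
import HarnessLib

/-!
# Itô's formula for Itô processes: the corrected fact, discharged

Sibling proof file of `Literature/Analysis/FunctionSpaces/ItoProcesses.lean`. That file records
Itô's formula for `C²` functions `f(t, Xₜ)` of an adapted Itô process `X = X₀ + ∫ b ds + ∫ σ dB`
driven by the canonical Brownian motion in two packagings: the original
`Literature.Analysis.FunctionSpaces.ito_formula_itoProcess`, which is **mis-stated** (nothing
forces the diffusion coefficient `σ` to have measurable paths; see its docstring), and the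
corrected `Literature.Analysis.FunctionSpaces.ito_formula_itoProcess_of_progressive` (extra
hypothesis: `σ` progressively measurable — Revuz–Yor's standing assumption on integrands,
Ch. IV, Def. (2.1), Def. (2.6)).

The corrected fact was reduced there (`ito_formula_itoProcess_of_progressive_of_facts`) to the
two named facts `Literature.Probability.Process.exists_isItoIntegral` (existence of the Itô
integral of a progressive `L²_loc` integrand) and
`Literature.Analysis.FunctionSpaces.ito_formula_itoProcess_ae` (the formula in integrated form).
Both have since been proved, in two sibling files which do not import each other:
`exists_isItoIntegral_holds` (`ItoIntegralLocalization.lean`) and `ito_formula_itoProcess_ae_holds`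
(`ItoFormulaProofs.lean`, which also records the half-way reduction
`ito_formula_itoProcess_of_progressive_of_exists`). This file imports both and closes the loop:
`Literature.Analysis.FunctionSpaces.ito_formula_itoProcess_of_progressive_holds`.

Nothing else is here; in particular the mis-stated `ito_formula_itoProcess` is *not* asserted.

## References

* D. Revuz, M. Yor, *Continuous Martingales and Brownian Motion* (3rd ed., 1999), Ch. IV,
  Thm (3.3) and Remark 1° after it (Itô's formula, time-dependent form `F(Xₜ, Aₜ)`),
  Def. (2.1), Def. (2.6) (integrands are progressively measurable), Prop. (2.7).
* K. Itô, *On stochastic differential equations*, Mem. Amer. Math. Soc. 4 (1951).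
-/

noncomputable section

namespace Literature.Analysis.FunctionSpaces

/-- **Itô's formula for Itô processes (corrected statement) holds**: discharge of the named fact
`ito_formula_itoProcess_of_progressive`. If `X = X₀ + ∫ b ds + ∫ σ dB` is an Itô process driven
by the canonical Brownian motion, adapted to the raw Brownian filtration, with progressively
measurable diffusion coefficient `σ`, and `f ∈ C²(ℝ × ℝ)`, then `f(t, Xₜ)` is an Itô process with
drift `∂ₜf(t, Xₜ) + bₜ ∂ₓf(t, Xₜ) + ½ σₜ² ∂ₓₓf(t, Xₜ)` and diffusion coefficient `σₜ ∂ₓf(t, Xₜ)`.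
Proof: the reduction `ito_formula_itoProcess_of_progressive_of_exists` (which already consumes
`ito_formula_itoProcess_ae_holds`) fed with `exists_isItoIntegral_holds`.
Revuz–Yor, *Continuous Martingales and Brownian Motion* (1999), Ch. IV, Thm (3.3) and
Remark 1° after it, with Def. (2.1), Def. (2.6), Prop. (2.7).
[cite: RevuzYor1999, Ch. IV Thm (3.3) and Remark 1] -/
theorem ito_formula_itoProcess_of_progressive_holds : ito_formula_itoProcess_of_progressive :=
  ito_formula_itoProcess_of_progressive_of_exists exists_isItoIntegral_holds

end Literature.Analysis.FunctionSpaces
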